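import Literature.Analysis.FunctionSpaces.PVToolkitArith
import HarnessLib

/-!
# A toolkit of `PV`-definable functions, IV: counted loops, bounded sums, fixed-width sequences

Topic `Literature/Analysis/FunctionSpaces`, continuing `PVToolkitArith.lean`.  The data layer for long
polynomial-time constructions inside Cobham's class `IsPVDefinable`:

* `loopNat base step k` — the `k`-fold loop `step (k-1) (⋯ (step 0 base))` with the round index
  available to the step, and **`IsPVDefinable.of_loopNat`**: it stays in Cobham's class when the number of
  rounds is at most a length `|S x|` and all intermediate values are bounded by a definable `Bd x`
  (limited recursion on the notation of the ruler `2^k - 1`);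
* `sumBelow`/`IsPVDefinable.of_sumBelow` (`∑_{i<k} h x i`), `countBelow`/`IsPVDefinable.of_countBelow`
  (`#{i < k : P x i ≠ 0}`), `muNat`/`IsPVDefinable.of_muNat` (least `i < k` with `P x i ≠ 0`, curried `μ`);
* fixed-width sequences: `dig b w i = ⌊w / 2^{ib}⌋ mod 2ᵇ` (`IsPVDefinable.of_dig`), the code
  `seqOf b f k = ∑_{i<k} (f i mod 2ᵇ) 2^{ib}` with `dig_seqOf`, `seqOf_lt`, and **`IsPVDefinable.of_seqOf`**
  (tabulating a definable function into a sequence: Buss's sharply bounded collection).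

## References

* S. R. Buss, *Bounded Arithmetic*, Bibliopolis 1986, §2.4–2.7 (sequence coding, `Σᵇ₁`-replacement).
* A. Cobham, *The intrinsic computational difficulty of functions*, 1965.
-/

namespace Literature.Analysis.FunctionSpaces

open PVFun Finset

variable {n : ℕ}

/-! ## Counted loops with a round index -/

/-- `loopNat base step k`: `k` rounds of `acc ↦ step i acc`, `i = 0, …, k - 1`. [folklore] -/
def loopNat (base : ℕ) (step : ℕ → ℕ → ℕ) : ℕ → ℕ
  | 0 => base
  | k + 1 => step k (loopNat base step k)

/-- No rounds. [folklore] -/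
@[simp] theorem loopNat_zero (base : ℕ) (step : ℕ → ℕ → ℕ) : loopNat base step 0 = base := rfl

/-- One more round. [folklore] -/
theorem loopNat_succ (base : ℕ) (step : ℕ → ℕ → ℕ) (k : ℕ) : loopNat base step (k + 1) = step k (loopNat base step k) := rfl

section Loop

variable {B K S Bd : (Fin n → ℕ) → ℕ} {St : (Fin n → ℕ) → ℕ → ℕ → ℕ}

/-- The loop by recursion on the notation of a ruler: with a bound that never bites, after `|r|` steps
the accumulator is `loopNat (B x) (St x) |r|`. [cite: Cobham1965] -/
theorem recN_loopNat (x : Fin n → ℕ) (r : ℕ) (hle : ∀ i ≤ r.size, loopNat (B x) (St x) i ≤ Bd x) :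
    recN B (fun _ x y acc => St x y.size acc) (fun x _ => Bd x) x r = loopNat (B x) (St x) r.size := by
  induction r using Nat.binaryRec' with
  | zero => simpa using hle 0 (by simp)
  | bit b y hy ih =>
    rw [recN_bit _ _ _ _ _ _ hy, size_bit_of_imp hy, loopNat_succ]
    rw [size_bit_of_imp hy] at hle
    rw [ih fun i hi => hle i (hi.trans (Nat.le_succ _))]
    exact min_eq_left (hle _ le_rfl)

/-- **Counted loops stay in Cobham's class**: `x ↦ loopNat (B x) (St x) (K x)` is definable when the
base, the step (as a function of `(x⃗, i, acc)`) and a bound `Bd` on all intermediate accumulators are,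
and the number of rounds is at most a length `|S x|`. [cite: Cobham1965] -/
theorem IsPVDefinable.of_loopNat (hB : IsPVDefinable B)
    (hSt : IsPVDefinable fun v : Fin (n + 2) → ℕ => St (Fin.init (Fin.init v)) (v (Fin.last n).castSucc) (v (Fin.last (n + 1))))
    (hK : IsPVDefinable K) (hS : IsPVDefinable S) (hKS : ∀ x, K x ≤ (S x).size) (hBd : IsPVDefinable Bd)
    (hle : ∀ x, ∀ i ≤ K x, loopNat (B x) (St x) i ≤ Bd x) :
    IsPVDefinable fun x => loopNat (B x) (St x) (K x) := by
  have hstep : ∀ b : Bool, IsPVDefinable fun v : Fin (n + 2) → ℕ =>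
      St (Fin.init (Fin.init v)) (v (Fin.last n).castSucc).size (v (Fin.last (n + 1))) := fun _ =>
    hSt.compVec (w := fun v => Fin.snoc (Fin.snoc (Fin.init (Fin.init v)) (v (Fin.last n).castSucc).size) (v (Fin.last (n + 1))))
      (IsPVDefinable.snoc_coord (IsPVDefinable.snoc_coord IsPVDefinable.init_init_coord (IsPVDefinable.proj _).len) (IsPVDefinable.proj _))
      |>.of_eq fun v => by simp
  have h := IsPVDefinable.of_recN (base := B) (step := fun _ x y acc => St x y.size acc) (bound := fun x _ => Bd x) hB hstep
    (hBd.compVec IsPVDefinable.init_coord)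
  -- the ruler `2^{K x} - 1`
  have hr : IsPVDefinable fun x => 2 ^ K x - 1 := (hK.two_pow_of_le hS hKS).pred
  refine (h.compVec (w := fun x => Fin.snoc x (2 ^ K x - 1)) (IsPVDefinable.snoc_coord IsPVDefinable.proj hr)).of_eq fun x => ?_
  simp only [Fin.init_snoc, Fin.snoc_last]
  rw [recN_loopNat x _ (by rw [size_two_pow_sub_one]; exact hle x), size_two_pow_sub_one]

end Loop

/-! ## Bounded sums and counts -/

/-- `sumBelow h k = ∑_{i<k} h i`. [folklore] -/
def sumBelow (h : ℕ → ℕ) (k : ℕ) : ℕ := ∑ i ∈ range k, h i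

/-- Sums as loops. [folklore] -/
theorem sumBelow_eq_loopNat (h : ℕ → ℕ) (k : ℕ) : sumBelow h k = loopNat 0 (fun i acc => acc + h i) k := by
  induction k with
  | zero => rfl
  | succ k ih => rw [sumBelow, sum_range_succ, ← sumBelow, ih, loopNat_succ]

section Sums

variable {h : (Fin n → ℕ) → ℕ → ℕ} {K S M : (Fin n → ℕ) → ℕ}

/-- **Bounded sums stay in Cobham's class**: `x ↦ ∑_{i < K x} h x i` for `K x ≤ |S x|` and summands
bounded by a definable `M x`. [cite: Buss1986, Ch. 1] -/
theorem IsPVDefinable.of_sumBelow (hh : IsPVDefinable fun v : Fin (n + 1) → ℕ => h (Fin.init v) (v (Fin.last n)))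
    (hK : IsPVDefinable K) (hS : IsPVDefinable S) (hKS : ∀ x, K x ≤ (S x).size) (hM : IsPVDefinable M)
    (hle : ∀ x, ∀ i < K x, h x i ≤ M x) : IsPVDefinable fun x => sumBelow (h x) (K x) := by
  have hSt : IsPVDefinable fun v : Fin (n + 2) → ℕ => v (Fin.last (n + 1)) + h (Fin.init (Fin.init v)) (v (Fin.last n).castSucc) :=
    (IsPVDefinable.proj _).add (hh.compVec (w := fun v => Fin.snoc (Fin.init (Fin.init v)) (v (Fin.last n).castSucc))
      (IsPVDefinable.snoc_coord IsPVDefinable.init_init_coord (IsPVDefinable.proj _)) |>.of_eq fun v => by simp)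
  refine (IsPVDefinable.of_loopNat (St := fun x i acc => acc + h x i) (IsPVDefinable.const 0) hSt hK hS hKS (hK.mul hM) fun x i hi => ?_).of_eq
    fun x => (sumBelow_eq_loopNat _ _).symm
  rw [← sumBelow_eq_loopNat, sumBelow]
  calc ∑ j ∈ range i, h x j ≤ ∑ j ∈ range i, M x := sum_le_sum fun j hj => hle x j (lt_of_lt_of_le (mem_range.1 hj) hi)
    _ = i * M x := by rw [sum_const, card_range, smul_eq_mul]
    _ ≤ K x * M x := Nat.mul_le_mul_right _ hi

end Sums

/-- `countBelow P k = #{i < k : P i ≠ 0}`. [folklore] -/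
def countBelow (P : ℕ → ℕ) (k : ℕ) : ℕ := ((range k).filter fun i => P i ≠ 0).card

/-- Counts as sums of indicators. [folklore] -/
theorem countBelow_eq_sumBelow (P : ℕ → ℕ) (k : ℕ) : countBelow P k = sumBelow (fun i => if P i = 0 then 0 else 1) k := by
  unfold countBelow sumBelow
  rw [card_filter]
  exact sum_congr rfl fun i _ => by by_cases h : P i = 0 <;> simp [h]

/-- Counts are at most the range. [folklore] -/
theorem countBelow_le (P : ℕ → ℕ) (k : ℕ) : countBelow P k ≤ k :=
  (card_filter_le _ _).trans (card_range k).le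

section Count

variable {P : (Fin n → ℕ) → ℕ → ℕ} {K S : (Fin n → ℕ) → ℕ}

/-- **Bounded counting stays in Cobham's class.** [cite: Buss1986, Ch. 1] -/
theorem IsPVDefinable.of_countBelow (hP : IsPVDefinable fun v : Fin (n + 1) → ℕ => P (Fin.init v) (v (Fin.last n)))
    (hK : IsPVDefinable K) (hS : IsPVDefinable S) (hKS : ∀ x, K x ≤ (S x).size) :
    IsPVDefinable fun x => countBelow (P x) (K x) := by
  refine (IsPVDefinable.of_sumBelow (h := fun x i => if P x i = 0 then 0 else 1) (hP.cond (IsPVDefinable.const 0) (IsPVDefinable.const 1))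
    hK hS hKS (IsPVDefinable.const 1) fun x i _ => ?_).of_eq fun x => (countBelow_eq_sumBelow _ _).symm
  split_ifs <;> simp

end Count

/-! ## Bounded search (curried `μ`) -/

/-- `muNat P k`: the least `i < k` with `P i ≠ 0`, and `k` if there is none — as a loop. [cite: Buss1986, Ch. 1] -/
def muNat (P : ℕ → ℕ) (k : ℕ) : ℕ := loopNat 0 (fun i acc => if acc < i then acc else if P i = 0 then i + 1 else i) k

/-- The defining properties of `muNat`. [cite: Buss1986, Ch. 1] -/
theorem muNat_spec (P : ℕ → ℕ) (k : ℕ) : muNat P k ≤ k ∧ (∀ i < muNat P k, P i = 0) ∧ (muNat P k < k → P (muNat P k) ≠ 0) := by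
  induction k with
  | zero => simp [muNat]
  | succ k ih =>
    obtain ⟨h1, h2, h3⟩ := ih
    have e : muNat P (k + 1) = (if muNat P k < k then muNat P k else if P k = 0 then k + 1 else k) := by
      unfold muNat; rw [loopNat_succ]
    rw [e]
    split_ifs with hlt hP
    · exact ⟨by omega, h2, fun _ => h3 hlt⟩
    · have hk : muNat P k = k := by omega
      refine ⟨le_rfl, fun i hi => ?_, fun h => absurd h (lt_irrefl _)⟩
      rcases Nat.lt_succ_iff_lt_or_eq.1 hi with hi | rfl
      · exact h2 i (by rw [hk]; exact hi)
      · exact hP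
    · have hk : muNat P k = k := by omega
      exact ⟨Nat.le_succ k, fun i hi => h2 i (by rw [hk]; exact hi), fun _ => hP⟩

/-- `muNat P k ≤ k`. [folklore] -/
theorem muNat_le (P : ℕ → ℕ) (k : ℕ) : muNat P k ≤ k := (muNat_spec P k).1

/-- Below `muNat` the test fails. [folklore] -/
theorem eq_zero_of_lt_muNat {P : ℕ → ℕ} {k i : ℕ} (hi : i < muNat P k) : P i = 0 := (muNat_spec P k).2.1 i hi

/-- At `muNat < k` the test holds. [folklore] -/
theorem ne_zero_muNat {P : ℕ → ℕ} {k : ℕ} (h : muNat P k < k) : P (muNat P k) ≠ 0 := (muNat_spec P k).2.2 h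

/-- Characterisation of `muNat` by its defining properties. [cite: Buss1986, Ch. 1] -/
theorem muNat_eq_of {P : ℕ → ℕ} {k m : ℕ} (hmk : m ≤ k) (hlt : ∀ z < m, P z = 0) (hm : m < k → P m ≠ 0) : muNat P k = m := by
  refine le_antisymm ?_ ?_
  · by_contra h; rw [not_le] at h
    exact hm (h.trans_le (muNat_le P k)) (eq_zero_of_lt_muNat h)
  · by_contra h; rw [not_le] at h
    exact ne_zero_muNat (h.trans_le hmk) (hlt _ h)

section Mu

variable {P : (Fin n → ℕ) → ℕ → ℕ} {K S : (Fin n → ℕ) → ℕ}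

/-- **Bounded search stays in Cobham's class.** [cite: Buss1986, Ch. 1] -/
theorem IsPVDefinable.of_muNat (hP : IsPVDefinable fun v : Fin (n + 1) → ℕ => P (Fin.init v) (v (Fin.last n)))
    (hK : IsPVDefinable K) (hS : IsPVDefinable S) (hKS : ∀ x, K x ≤ (S x).size) :
    IsPVDefinable fun x => muNat (P x) (K x) := by
  have hi : IsPVDefinable fun v : Fin (n + 2) → ℕ => v (Fin.last n).castSucc := IsPVDefinable.proj _
  have hacc : IsPVDefinable fun v : Fin (n + 2) → ℕ => v (Fin.last (n + 1)) := IsPVDefinable.proj _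
  have hPi : IsPVDefinable fun v : Fin (n + 2) → ℕ => P (Fin.init (Fin.init v)) (v (Fin.last n).castSucc) :=
    hP.compVec (w := fun v => Fin.snoc (Fin.init (Fin.init v)) (v (Fin.last n).castSucc))
      (IsPVDefinable.snoc_coord IsPVDefinable.init_init_coord hi) |>.of_eq fun v => by simp
  have hSt : IsPVDefinable fun v : Fin (n + 2) → ℕ =>
      (if v (Fin.last (n + 1)) < v (Fin.last n).castSucc then v (Fin.last (n + 1))
        else if P (Fin.init (Fin.init v)) (v (Fin.last n).castSucc) = 0 then v (Fin.last n).castSucc + 1 else v (Fin.last n).castSucc) :=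
    hacc.ite_lt hi hacc (hPi.cond hi.succ hi)
  refine IsPVDefinable.of_loopNat (St := fun x i acc => if acc < i then acc else if P x i = 0 then i + 1 else i)
    (IsPVDefinable.const 0) hSt hK hS hKS hK fun x i hi => (muNat_le (P x) i).trans hi

end Mu

/-! ## Fixed-width sequences -/

/-- The digit `i` of width `b` of `w`: `⌊w / 2^{ib}⌋ mod 2ᵇ`. [cite: Buss1986, §2.5] -/
def dig (b w i : ℕ) : ℕ := w / 2 ^ (i * b) % 2 ^ b

/-- Digits are `< 2ᵇ`. [folklore] -/
theorem dig_lt (b w i : ℕ) : dig b w i < 2 ^ b := Nat.mod_lt _ (by positivity)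

/-- **Digits are in Cobham's class.** [cite: Buss1986, §2.5] -/
theorem pv_dig : PV₃ dig := by
  unfold PV₃ dig
  exact ((IsPVDefinable.proj 1).shiftRight ((IsPVDefinable.proj 2).mul (IsPVDefinable.proj 0))).modPow (IsPVDefinable.proj 0)

/-- Digits of definable data. [cite: Buss1986, §2.5] -/
theorem IsPVDefinable.of_dig {Bw W I : (Fin n → ℕ) → ℕ} (hB : IsPVDefinable Bw) (hW : IsPVDefinable W) (hI : IsPVDefinable I) :
    IsPVDefinable fun x => dig (Bw x) (W x) (I x) := pv_dig.comp hB hW hI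

/-- The code of the sequence `f 0, …, f (k-1)` in digits of width `b` (entries reduced mod `2ᵇ`). [cite: Buss1986, §2.5] -/
def seqOf (b : ℕ) (f : ℕ → ℕ) (k : ℕ) : ℕ := ∑ i ∈ range k, f i % 2 ^ b * 2 ^ (i * b)

/-- The code is `< 2^{kb}`. [folklore] -/
theorem seqOf_lt (b : ℕ) (f : ℕ → ℕ) (k : ℕ) : seqOf b f k < 2 ^ (k * b) :=
  sum_digit_mul_pow_lt (fun i => Nat.mod_lt _ (by positivity)) k

/-- One more entry. [folklore] -/
theorem seqOf_succ (b : ℕ) (f : ℕ → ℕ) (k : ℕ) : seqOf b f (k + 1) = seqOf b f k + f k % 2 ^ b * 2 ^ (k * b) := by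
  unfold seqOf; rw [sum_range_succ]

/-- **Reading a sequence**: for `i < k`, `dig b (seqOf b f k) i = f i mod 2ᵇ`. [cite: Buss1986, §2.5] -/
theorem dig_seqOf {b : ℕ} {f : ℕ → ℕ} {i k : ℕ} (hi : i < k) : dig b (seqOf b f k) i = f i % 2 ^ b :=
  sum_digit_div_mod (d := fun i => f i % 2 ^ b) (fun i => Nat.mod_lt _ (by positivity)) hi

/-- Reading back exact values when they fit. [cite: Buss1986, §2.5] -/
theorem dig_seqOf_of_lt {b : ℕ} {f : ℕ → ℕ} {i k : ℕ} (hi : i < k) (hf : f i < 2 ^ b) : dig b (seqOf b f k) i = f i := by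
  rw [dig_seqOf hi, Nat.mod_eq_of_lt hf]

/-- The code only depends on the entries below `k`. [folklore] -/
theorem seqOf_congr {b : ℕ} {f g : ℕ → ℕ} {k : ℕ} (h : ∀ i < k, f i = g i) : seqOf b f k = seqOf b g k :=
  sum_congr rfl fun i hi => by rw [h i (mem_range.1 hi)]

/-- `seqOf` as a loop. [folklore] -/
theorem seqOf_eq_loopNat (b : ℕ) (f : ℕ → ℕ) (k : ℕ) : seqOf b f k = loopNat 0 (fun i acc => acc + f i % 2 ^ b * 2 ^ (i * b)) k := by
  induction k with
  | zero => rfl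
  | succ k ih => rw [seqOf_succ, ih, loopNat_succ]

/-- Loops with steps agreeing below `k` agree. [folklore] -/
theorem loopNat_congr {base : ℕ} {st st' : ℕ → ℕ → ℕ} {k : ℕ} (h : ∀ i < k, ∀ acc, st i acc = st' i acc) :
    loopNat base st k = loopNat base st' k := by
  induction k with
  | zero => rfl
  | succ k ih =>
    rw [loopNat_succ, loopNat_succ, ih fun i hi acc => h i (Nat.lt_succ_of_lt hi) acc, h k (Nat.lt_succ_self k)]

section Seq

variable {g : (Fin n → ℕ) → ℕ → ℕ} {Bw K S T : (Fin n → ℕ) → ℕ}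

/-- **Tabulating a definable function into a sequence stays in Cobham's class** (`K x ≤ |S x|` entries
of width `Bw x ≤ |T x|`; Buss's sharply bounded collection). [cite: Buss1986, §2.5] -/
theorem IsPVDefinable.of_seqOf (hg : IsPVDefinable fun v : Fin (n + 1) → ℕ => g (Fin.init v) (v (Fin.last n)))
    (hB : IsPVDefinable Bw) (hK : IsPVDefinable K) (hS : IsPVDefinable S) (hT : IsPVDefinable T)
    (hKS : ∀ x, K x ≤ (S x).size) (hBT : ∀ x, Bw x ≤ (T x).size) :
    IsPVDefinable fun x => seqOf (Bw x) (g x) (K x) := by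
  have hBii : IsPVDefinable fun v : Fin (n + 2) → ℕ => Bw (Fin.init (Fin.init v)) := hB.compVec IsPVDefinable.init_init_coord
  have hTii : IsPVDefinable fun v : Fin (n + 2) → ℕ => T (Fin.init (Fin.init v)) := hT.compVec IsPVDefinable.init_init_coord
  have hSii : IsPVDefinable fun v : Fin (n + 2) → ℕ => S (Fin.init (Fin.init v)) := hS.compVec IsPVDefinable.init_init_coord
  have hi : IsPVDefinable fun v : Fin (n + 2) → ℕ => v (Fin.last n).castSucc := IsPVDefinable.proj _
  have hgi : IsPVDefinable fun v : Fin (n + 2) → ℕ => g (Fin.init (Fin.init v)) (v (Fin.last n).castSucc) :=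
    hg.compVec (w := fun v => Fin.snoc (Fin.init (Fin.init v)) (v (Fin.last n).castSucc))
      (IsPVDefinable.snoc_coord IsPVDefinable.init_init_coord hi) |>.of_eq fun v => by simp
  have hpowb : IsPVDefinable fun v : Fin (n + 2) → ℕ => 2 ^ Bw (Fin.init (Fin.init v)) := hBii.two_pow_of_le hTii fun v => hBT _
  -- the step, with the power written as `(2^b)^{min i |S|}` (total and definable; agrees with `2^{ib}` for `i ≤ |S x|`)
  set St : (Fin n → ℕ) → ℕ → ℕ → ℕ := fun x i acc => acc + g x i % 2 ^ Bw x * (2 ^ Bw x) ^ min i (S x).size with hSt_def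
  have hSt : IsPVDefinable fun v : Fin (n + 2) → ℕ => St (Fin.init (Fin.init v)) (v (Fin.last n).castSucc) (v (Fin.last (n + 1))) :=
    (IsPVDefinable.proj _).add ((hgi.modPow hBii).mul (hpowb.powLen hi hSii))
  have key : ∀ x, ∀ k ≤ (S x).size, loopNat 0 (St x) k = seqOf (Bw x) (g x) k := fun x k hk => by
    rw [seqOf_eq_loopNat]
    refine loopNat_congr fun i hi acc => ?_
    simp only [hSt_def, min_eq_left (hi.le.trans hk), ← pow_mul, mul_comm (Bw x) i]
  have hBd : IsPVDefinable fun x => 2 ^ ((S x).size * (T x).size) := hS.smash hT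
  refine (IsPVDefinable.of_loopNat (St := St) (IsPVDefinable.const 0) hSt hK hS hKS hBd fun x i hi => ?_).of_eq fun x => key x _ (hKS x)
  rw [key x i (hi.trans (hKS x))]
  calc seqOf (Bw x) (g x) i ≤ 2 ^ (i * Bw x) := (seqOf_lt _ _ _).le
    _ ≤ 2 ^ ((S x).size * (T x).size) := Nat.pow_le_pow_right two_pos (Nat.mul_le_mul (hi.trans (hKS x)) (hBT x))

end Seq

/-! ## Curried corollaries (one datum `a`, or a datum and a parameter `a, p`) -/

section Curried

/-- Vectors of length one and two, three as curried arguments. [folklore] -/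
theorem pv₁_iff {F : (Fin 1 → ℕ) → ℕ} : IsPVDefinable F ↔ PV₁ fun a => F ![a] :=
  ⟨fun h => h.of_eq fun v => by congr 1; ext i; fin_cases i; rfl, fun h => (PV₁.comp h (IsPVDefinable.proj 0)).of_eq fun v => by
    congr 1; ext i; fin_cases i; rfl⟩

/-- Vectors of length two as curried arguments. [folklore] -/
theorem pv₂_iff {F : (Fin 2 → ℕ) → ℕ} : IsPVDefinable F ↔ PV₂ fun a b => F ![a, b] :=
  ⟨fun h => h.of_eq fun v => by congr 1; ext i; fin_cases i <;> rfl, fun h => (PV₂.comp h (IsPVDefinable.proj 0) (IsPVDefinable.proj 1)).of_eq fun v => by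
    congr 1; ext i; fin_cases i <;> rfl⟩

/-- Vectors of length three as curried arguments. [folklore] -/
theorem pv₃_iff {F : (Fin 3 → ℕ) → ℕ} : IsPVDefinable F ↔ PV₃ fun a b c => F ![a, b, c] :=
  ⟨fun h => h.of_eq fun v => by congr 1; ext i; fin_cases i <;> rfl,
    fun h => (PV₃.comp h (IsPVDefinable.proj 0) (IsPVDefinable.proj 1) (IsPVDefinable.proj 2)).of_eq fun v => by congr 1; ext i; fin_cases i <;> rfl⟩

variable {h₂ P₂ : ℕ → ℕ → ℕ} {h₃ P₃ St₃ : ℕ → ℕ → ℕ → ℕ} {St₄ : ℕ → ℕ → ℕ → ℕ → ℕ} {K S M T B Bd : ℕ → ℕ} {K₂ S₂ M₂ T₂ B₂ Bd₂ : ℕ → ℕ → ℕ}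

/-- Curried loop, one datum. [cite: Cobham1965] -/
theorem PV₁.loopNat (hB : PV₁ B) (hSt : PV₃ St₃) (hK : PV₁ K) (hS : PV₁ S) (hKS : ∀ a, K a ≤ (S a).size) (hBd : PV₁ Bd)
    (hle : ∀ a, ∀ i ≤ K a, loopNat (B a) (St₃ a) i ≤ Bd a) : PV₁ fun a => loopNat (B a) (St₃ a) (K a) :=
  IsPVDefinable.of_loopNat (n := 1) (B := fun x => B (x 0)) (St := fun x => St₃ (x 0)) (K := fun x => K (x 0)) (S := fun x => S (x 0))
    (Bd := fun x => Bd (x 0)) hB (hSt.comp (IsPVDefinable.proj 0) (IsPVDefinable.proj 1) (IsPVDefinable.proj 2)) hK hS (fun _ => hKS _) hBd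
    fun _ => hle _

/-- Curried loop, a datum and a parameter. [cite: Cobham1965] -/
theorem PV₂.loopNat (hB : PV₂ B₂) (hSt : PV₄ St₄) (hK : PV₂ K₂) (hS : PV₂ S₂) (hKS : ∀ a p, K₂ a p ≤ (S₂ a p).size) (hBd : PV₂ Bd₂)
    (hle : ∀ a p, ∀ i ≤ K₂ a p, loopNat (B₂ a p) (St₄ a p) i ≤ Bd₂ a p) : PV₂ fun a p => loopNat (B₂ a p) (St₄ a p) (K₂ a p) :=
  IsPVDefinable.of_loopNat (n := 2) (B := fun x => B₂ (x 0) (x 1)) (St := fun x => St₄ (x 0) (x 1)) (K := fun x => K₂ (x 0) (x 1))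
    (S := fun x => S₂ (x 0) (x 1)) (Bd := fun x => Bd₂ (x 0) (x 1)) hB
    (hSt.comp (IsPVDefinable.proj 0) (IsPVDefinable.proj 1) (IsPVDefinable.proj 2) (IsPVDefinable.proj 3)) hK hS (fun _ => hKS _ _) hBd
    fun _ => hle _ _

/-- Curried bounded sum, one datum. [cite: Buss1986, Ch. 1] -/
theorem PV₁.sumBelow (hh : PV₂ h₂) (hK : PV₁ K) (hS : PV₁ S) (hKS : ∀ a, K a ≤ (S a).size) (hM : PV₁ M)
    (hle : ∀ a, ∀ i < K a, h₂ a i ≤ M a) : PV₁ fun a => sumBelow (h₂ a) (K a) :=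
  IsPVDefinable.of_sumBelow (n := 1) (h := fun x => h₂ (x 0)) (K := fun x => K (x 0)) (S := fun x => S (x 0)) (M := fun x => M (x 0))
    (hh.comp (IsPVDefinable.proj 0) (IsPVDefinable.proj 1)) hK hS (fun _ => hKS _) hM fun _ => hle _

/-- Curried bounded sum, a datum and a parameter. [cite: Buss1986, Ch. 1] -/
theorem PV₂.sumBelow (hh : PV₃ h₃) (hK : PV₂ K₂) (hS : PV₂ S₂) (hKS : ∀ a p, K₂ a p ≤ (S₂ a p).size) (hM : PV₂ M₂)
    (hle : ∀ a p, ∀ i < K₂ a p, h₃ a p i ≤ M₂ a p) : PV₂ fun a p => sumBelow (h₃ a p) (K₂ a p) :=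
  IsPVDefinable.of_sumBelow (n := 2) (h := fun x => h₃ (x 0) (x 1)) (K := fun x => K₂ (x 0) (x 1)) (S := fun x => S₂ (x 0) (x 1))
    (M := fun x => M₂ (x 0) (x 1)) (hh.comp (IsPVDefinable.proj 0) (IsPVDefinable.proj 1) (IsPVDefinable.proj 2)) hK hS (fun _ => hKS _ _) hM
    fun _ => hle _ _

/-- Curried bounded count, one datum. [cite: Buss1986, Ch. 1] -/
theorem PV₁.countBelow (hP : PV₂ P₂) (hK : PV₁ K) (hS : PV₁ S) (hKS : ∀ a, K a ≤ (S a).size) : PV₁ fun a => countBelow (P₂ a) (K a) :=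
  IsPVDefinable.of_countBelow (n := 1) (P := fun x => P₂ (x 0)) (K := fun x => K (x 0)) (S := fun x => S (x 0))
    (hP.comp (IsPVDefinable.proj 0) (IsPVDefinable.proj 1)) hK hS fun _ => hKS _

/-- Curried bounded count, a datum and a parameter. [cite: Buss1986, Ch. 1] -/
theorem PV₂.countBelow (hP : PV₃ P₃) (hK : PV₂ K₂) (hS : PV₂ S₂) (hKS : ∀ a p, K₂ a p ≤ (S₂ a p).size) :
    PV₂ fun a p => countBelow (P₃ a p) (K₂ a p) :=
  IsPVDefinable.of_countBelow (n := 2) (P := fun x => P₃ (x 0) (x 1)) (K := fun x => K₂ (x 0) (x 1)) (S := fun x => S₂ (x 0) (x 1))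
    (hP.comp (IsPVDefinable.proj 0) (IsPVDefinable.proj 1) (IsPVDefinable.proj 2)) hK hS fun _ => hKS _ _

/-- Curried bounded search, one datum. [cite: Buss1986, Ch. 1] -/
theorem PV₁.muNat (hP : PV₂ P₂) (hK : PV₁ K) (hS : PV₁ S) (hKS : ∀ a, K a ≤ (S a).size) : PV₁ fun a => muNat (P₂ a) (K a) :=
  IsPVDefinable.of_muNat (n := 1) (P := fun x => P₂ (x 0)) (K := fun x => K (x 0)) (S := fun x => S (x 0))
    (hP.comp (IsPVDefinable.proj 0) (IsPVDefinable.proj 1)) hK hS fun _ => hKS _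

/-- Curried bounded search, a datum and a parameter. [cite: Buss1986, Ch. 1] -/
theorem PV₂.muNat (hP : PV₃ P₃) (hK : PV₂ K₂) (hS : PV₂ S₂) (hKS : ∀ a p, K₂ a p ≤ (S₂ a p).size) :
    PV₂ fun a p => muNat (P₃ a p) (K₂ a p) :=
  IsPVDefinable.of_muNat (n := 2) (P := fun x => P₃ (x 0) (x 1)) (K := fun x => K₂ (x 0) (x 1)) (S := fun x => S₂ (x 0) (x 1))
    (hP.comp (IsPVDefinable.proj 0) (IsPVDefinable.proj 1) (IsPVDefinable.proj 2)) hK hS fun _ => hKS _ _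

/-- Curried tabulation, one datum. [cite: Buss1986, §2.5] -/
theorem PV₁.seqOf (hg : PV₂ h₂) (hB : PV₁ B) (hK : PV₁ K) (hS : PV₁ S) (hT : PV₁ T) (hKS : ∀ a, K a ≤ (S a).size) (hBT : ∀ a, B a ≤ (T a).size) :
    PV₁ fun a => seqOf (B a) (h₂ a) (K a) :=
  IsPVDefinable.of_seqOf (n := 1) (g := fun x => h₂ (x 0)) (Bw := fun x => B (x 0)) (K := fun x => K (x 0)) (S := fun x => S (x 0))
    (T := fun x => T (x 0)) (hg.comp (IsPVDefinable.proj 0) (IsPVDefinable.proj 1)) hB hK hS hT (fun _ => hKS _) fun _ => hBT _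

/-- Curried tabulation, a datum and a parameter. [cite: Buss1986, §2.5] -/
theorem PV₂.seqOf (hg : PV₃ h₃) (hB : PV₂ B₂) (hK : PV₂ K₂) (hS : PV₂ S₂) (hT : PV₂ T₂) (hKS : ∀ a p, K₂ a p ≤ (S₂ a p).size)
    (hBT : ∀ a p, B₂ a p ≤ (T₂ a p).size) : PV₂ fun a p => seqOf (B₂ a p) (h₃ a p) (K₂ a p) :=
  IsPVDefinable.of_seqOf (n := 2) (g := fun x => h₃ (x 0) (x 1)) (Bw := fun x => B₂ (x 0) (x 1)) (K := fun x => K₂ (x 0) (x 1))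
    (S := fun x => S₂ (x 0) (x 1)) (T := fun x => T₂ (x 0) (x 1)) (hg.comp (IsPVDefinable.proj 0) (IsPVDefinable.proj 1) (IsPVDefinable.proj 2))
    hB hK hS hT (fun _ => hKS _ _) fun _ => hBT _ _

end Curried

end Literature.Analysis.FunctionSpaces
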